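import Mathlib

/-!
# GirthSidon / ToricSwallowForcesShortRelation — dense cores and the edge count (support file 3/3)

Support file for item `stmt-ValiantsHypothesis-6538` (`ToricSwallowForcesShortRelation`) of route
GirthSidon (problem `ValiantsHypothesis`).  Counting lemmas about a family
`verts : ι → Multiset V` of "endpoint multisets":

* `exists_core`: if `|A| > c · |V|` and no `verts i` (`i ∈ A`) is empty, some nonempty
  `W ⊆ V` has every vertex on at least `c` members of `A` lying inside `W`
  (maximise `#(edges inside W) - c · |W|`; the classical minimum-degree core).
* `card_filter_pair_nodup_ge`: if `verts` is injective with `1 ≤ |verts i| ≤ 2`, all but at most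
  `2 |V|` indices carry a genuine edge `{a, b}`, `a ≠ b` (the others are `{a}` or `{a, a}`).
* `card_filter_mem_le_card_nbrs`: with `verts` injective, the number of genuine edges at `v` is at
  most the number of neighbours of `v`.

Everything here is folklore.
-/

set_option linter.dupNamespace false -- single-conjunct summit: `ValiantsHypothesis.ValiantsHypothesis`

namespace Summit.ValiantsHypothesis.ValiantsHypothesis.Theorems.GirthSidonToric

open Finset

variable {V ι : Type*}

/-- **Minimum-degree core.** If `c · |V| < |A|` and every `verts i` (`i ∈ A`) is nonempty, there is
a nonempty `W` such that every `v ∈ W` lies on at least `c` members of `A` whose endpoints are all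
in `W`. [folklore] -/
theorem exists_core [DecidableEq V] [Fintype V] (A : Finset ι) (verts : ι → Multiset V)
    (hA : ∀ i ∈ A, verts i ≠ 0) (c : ℕ) (hc : c * Fintype.card V < A.card) :
    ∃ W : Finset V, W.Nonempty ∧ ∀ v ∈ W,
      c ≤ ((A.filter fun i => ∀ u ∈ verts i, u ∈ W).filter fun i => v ∈ verts i).card := by
  -- maximise `f W = #(edges inside W) - c |W|`
  set f : Finset V → ℤ := fun W => ((A.filter fun i => ∀ u ∈ verts i, u ∈ W).card : ℤ) - c * W.card
    with hf
  obtain ⟨W, -, hW⟩ := exists_max_image (univ : Finset (Finset V)) f univ_nonempty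
  have hfuniv : f univ = (A.card : ℤ) - c * Fintype.card V := by
    simp only [hf, mem_univ, implies_true, filter_true_of_mem, card_univ]
  have hfempty : f ∅ = 0 := by
    have : (A.filter fun i => ∀ u ∈ verts i, u ∈ (∅ : Finset V)) = ∅ :=
      filter_eq_empty_iff.2 fun i hi h =>
        hA i hi (Multiset.eq_zero_of_forall_notMem fun u hu => by simpa using h u hu)
    show ((A.filter fun i => ∀ u ∈ verts i, u ∈ (∅ : Finset V)).card : ℤ) - c * (∅ : Finset V).card
      = 0
    rw [this, card_empty, card_empty]
    simp
  have hWpos : 0 < f W := by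
    have := hW univ (mem_univ _)
    rw [hfuniv] at this
    have hc' : ((c * Fintype.card V : ℕ) : ℤ) < (A.card : ℤ) := by exact_mod_cast hc
    push_cast at hc'
    linarith
  refine ⟨W, ?_, fun v hv => ?_⟩
  · rw [nonempty_iff_ne_empty]
    rintro rfl
    rw [hfempty] at hWpos
    exact lt_irrefl _ hWpos
  · -- compare `W` with `W.erase v`
    have hle := hW (W.erase v) (mem_univ _)
    have hsplit : (A.filter fun i => ∀ u ∈ verts i, u ∈ W.erase v) =
        (A.filter fun i => ∀ u ∈ verts i, u ∈ W).filter fun i => v ∉ verts i := by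
      ext i
      simp only [mem_filter, mem_erase]
      constructor
      · rintro ⟨hi, h⟩
        exact ⟨⟨hi, fun u hu => (h u hu).2⟩, fun hv => (h v hv).1 rfl⟩
      · rintro ⟨⟨hi, h⟩, hv⟩
        exact ⟨hi, fun u hu => ⟨fun huv => hv (huv ▸ hu), h u hu⟩⟩
    have hcnt := Finset.card_filter_add_card_filter_not
      (s := A.filter fun i => ∀ u ∈ verts i, u ∈ W) (fun i => v ∈ verts i)
    have hcard : (W.erase v).card + 1 = W.card := card_erase_add_one hv
    simp only [hf, hsplit] at hle
    push_cast [← hcnt, ← hcard] at hle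
    have : (c : ℤ) ≤ (((A.filter fun i => ∀ u ∈ verts i, u ∈ W).filter
        fun i => v ∈ verts i).card : ℤ) := by linarith
    exact_mod_cast this

/-- A two-element multiset is duplicate-free iff its elements differ. [folklore] -/
theorem nodup_pair_iff {a b : V} : ({a, b} : Multiset V).Nodup ↔ a ≠ b := by
  rw [Multiset.insert_eq_cons, Multiset.nodup_cons]
  simp

/-- **Edge count.** For an injective family of multisets of sizes `1` or `2` over `V`, all but at
most `2 |V|` of them are genuine edges `{a, b}` with `a ≠ b`. [folklore] -/
theorem card_filter_not_edge_le [DecidableEq V] [Fintype V] [Fintype ι] (verts : ι → Multiset V)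
    (hinj : Function.Injective verts) (h1 : ∀ i, verts i ≠ 0)
    (h2 : ∀ i, Multiset.card (verts i) ≤ 2) :
    (univ.filter fun i => ¬ (Multiset.card (verts i) = 2 ∧ (verts i).Nodup)).card ≤
      2 * Fintype.card V := by
  classical
  -- loops `{a, a}` and singletons `{a}`
  have hB1 : (univ.filter fun i => Multiset.card (verts i) = 1).card ≤ Fintype.card V := by
    calc (univ.filter fun i => Multiset.card (verts i) = 1).card
        ≤ (univ.image fun a : V => ({a} : Multiset V)).card := by
          refine card_le_card_of_injOn verts (fun i hi => ?_) (hinj.injOn)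
          rw [mem_coe, mem_filter] at hi
          obtain ⟨a, ha⟩ := Multiset.card_eq_one.1 hi.2
          exact mem_coe.2 (mem_image.2 ⟨a, mem_univ _, ha.symm⟩)
      _ ≤ Fintype.card V := card_image_le.trans (card_univ (α := V)).le
  have hB2 : (univ.filter fun i => Multiset.card (verts i) = 2 ∧ ¬ (verts i).Nodup).card ≤
      Fintype.card V := by
    calc (univ.filter fun i => Multiset.card (verts i) = 2 ∧ ¬ (verts i).Nodup).card
        ≤ (univ.image fun a : V => ({a, a} : Multiset V)).card := by
          refine card_le_card_of_injOn verts (fun i hi => ?_) (hinj.injOn)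
          rw [mem_coe, mem_filter] at hi
          obtain ⟨a, b, hab⟩ := Multiset.card_eq_two.1 hi.2.1
          have : a = b := by
            by_contra hne
            exact hi.2.2 (hab ▸ nodup_pair_iff.2 hne)
          subst this
          exact mem_coe.2 (mem_image.2 ⟨a, mem_univ _, hab.symm⟩)
      _ ≤ Fintype.card V := card_image_le.trans (card_univ (α := V)).le
  have hsub : (univ.filter fun i => ¬ (Multiset.card (verts i) = 2 ∧ (verts i).Nodup)) ⊆
      (univ.filter fun i => Multiset.card (verts i) = 1) ∪
        (univ.filter fun i => Multiset.card (verts i) = 2 ∧ ¬ (verts i).Nodup) := by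
    intro i hi
    rw [mem_filter] at hi
    rw [mem_union, mem_filter, mem_filter]
    have hc0 : Multiset.card (verts i) ≠ 0 := fun h => h1 i (Multiset.card_eq_zero.1 h)
    have hc2 := h2 i
    by_cases hci : Multiset.card (verts i) = 2
    · exact Or.inr ⟨mem_univ _, hci, fun hnd => hi.2 ⟨hci, hnd⟩⟩
    · exact Or.inl ⟨mem_univ _, by omega⟩
  exact (card_le_card hsub).trans ((card_union_le _ _).trans (by omega))

/-- **Edges at `v` versus neighbours of `v`.** For an injective family of genuine edges inside `W`,
the number of edges of `A` through `v` is at most the number of neighbours of `v` in `W`.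
[folklore] -/
theorem card_filter_mem_le_card_nbrs [DecidableEq V] [DecidableEq ι] (A : Finset ι)
    (verts : ι → Multiset V) (W : Finset V) (hinj : Set.InjOn verts A)
    (hA : ∀ i ∈ A, ∃ a ∈ W, ∃ b ∈ W, a ≠ b ∧ verts i = {a, b}) (v : V) :
    (A.filter fun i => v ∈ verts i).card ≤ (W.filter fun x => ∃ i ∈ A, verts i = {v, x}).card := by
  calc (A.filter fun i => v ∈ verts i).card
      ≤ ((W.filter fun x => ∃ i ∈ A, verts i = {v, x}).image fun x => ({x} : Multiset V)).card := by
        refine card_le_card_of_injOn (fun i => (verts i).erase v) (fun i hi => ?_) ?_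
        · rw [mem_coe, mem_filter] at hi
          obtain ⟨hiA, hvi⟩ := hi
          obtain ⟨a, ha, b, hb, hab, he⟩ := hA i hiA
          rw [mem_coe, mem_image]
          rw [he, Multiset.insert_eq_cons, Multiset.mem_cons, Multiset.mem_singleton] at hvi
          rcases hvi with rfl | rfl
          · refine ⟨b, mem_filter.2 ⟨hb, i, hiA, he⟩, ?_⟩
            simp [he]
          · refine ⟨a, mem_filter.2 ⟨ha, i, hiA, he.trans (Multiset.pair_comm a v)⟩, ?_⟩
            show ({a} : Multiset V) = (verts i).erase v
            rw [he, Multiset.insert_eq_cons, Multiset.erase_cons_tail _ hab]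
            simp
        · intro i hi j hj hij
          rw [mem_coe, mem_filter] at hi hj
          simp only at hij
          have := congrArg (Multiset.cons v) hij
          rw [Multiset.cons_erase hi.2, Multiset.cons_erase hj.2] at this
          exact hinj hi.1 hj.1 this
    _ ≤ (W.filter fun x => ∃ i ∈ A, verts i = {v, x}).card := card_image_le

end Summit.ValiantsHypothesis.ValiantsHypothesis.Theorems.GirthSidonToric
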